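import Mathlib.RingTheory.Ideal.Operations
import Mathlib.RingTheory.Ideal.Maps
import Mathlib.Data.Finsupp.Weight
import Mathlib.Tactic
import Literature.AlgebraicGeometry.Resolution.CobordantBlowupFiltration
import HarnessLib

/-!
# Weighted monomial ideals of a permutable regular family: splitting and colon ideals

Topic: `Literature/AlgebraicGeometry/Resolution`. Commutative algebra behind the regularity of
Włodarczyk's full cobordant blow-up `B = Spec A[t⁻¹, u₁ t^{w₁}, …, u_k t^{w_k}]` at a regular weighted
centre (J. Włodarczyk, *Functorial resolution by torus actions*, arXiv:2203.03090, §2.3.9: "`B` is a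
regular closed subscheme of `X × 𝔸ⁿ⁺¹`"), route `ResolutionOfSingularities/WeightedInvariant`
(support item `DatumToEmbedded`, stmt-0572: the datum's transform `B₊` must again be smooth over the
perfect ground field, i.e. regular). For a family `u : ι → A`, weights `w : ι → ℕ` and a set of
indices `S`, write (local notation, no new definition)

  `J[S, m] = (u^β : supp β ⊆ S, Σ wᵢ βᵢ ≥ m)`

for the weighted monomial ideals of the sub-family on `S` — the pieces of the weighted filtration
`weightedFiltration` of `CobordantBlowupFiltration.lean` when `S` is everything. PROVED here, for a
*permutable regular family modulo an ideal `K`* (each `uᵢ`, `i ∈ S`, is a non-zero-divisor modulo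
`K + (u_t : t ∈ T)` for all `T ⊆ S ∖ {i}` — e.g. part of a regular system of parameters of a regular
local ring, `RegularQuotientIdeal.lean`):

* `weightedSpan_eq_sup` — **splitting off a parameter**: `J[S, m] = u_v J[S, m − w_v] + J[S ∖ v, m]`;
* `colon_weightedSpan_aux` — **the colon lemmas** `(K + J[S, m] : x) = K + J[S, m]` for `x` a
  non-zero-divisor modulo all `K + (u_T)`, and `(K + J[S, m] : u_v) = K + J[S, m − w_v]`, by induction
  on `S` and `m` — the weighted form of `(I^m : u_v) = I^{m−1}` for an ideal generated by a regular
  sequence (Matsumura, *Commutative Ring Theory*, Thm. 16.2).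

The weighted quasi-regularity itself (graded ring of the weighted filtration = weighted polynomial
ring) is `WeightedMonomialQuasiRegular.lean`.

## Sources

* H. Matsumura, *Commutative Ring Theory*, CUP 1986, §16 (Thm. 16.2). [Matsumura1987]
* J. Włodarczyk, arXiv:2203.03090, Lemma 2.1.9 (the ideals `(u^α : Σ αᵢwᵢ ≥ a)`), §2.3.9.
  [Wlodarczyk2022]
-/

noncomputable section

namespace Literature.AlgebraicGeometry.Resolution

universe u v

variable {A : Type u} [CommRing A] {ι : Type v} (u : ι → A) (w : ι → ℕ)

/-- The weighted monomial ideal `J[S, m] = (u^β : supp β ⊆ S, Σ wᵢ βᵢ ≥ m)` of the sub-family of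
`u` indexed by `S` (local notation). -/
local notation3 "J[" S ", " m "]" => Ideal.span {x : A | ∃ β : ι →₀ ℕ, (↑β.support : Set ι) ⊆ S ∧
  m ≤ Finsupp.weight w β ∧ β.prod (fun i e => u i ^ e) = x}

/-- Monomials of weight `≥ m` supported in `S` lie in `J[S, m]`. [folklore] -/
theorem prod_mem_weightedSpan {S : Set ι} {m : ℕ} {β : ι →₀ ℕ} (hS : (↑β.support : Set ι) ⊆ S)
    (hm : m ≤ Finsupp.weight w β) : β.prod (fun i e => u i ^ e) ∈ J[S, m] :=
  Ideal.subset_span ⟨β, hS, hm, rfl⟩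

/-- `J[S, m]` decreases in `m`. [folklore] -/
theorem weightedSpan_antitone (S : Set ι) {m n : ℕ} (h : m ≤ n) : J[S, n] ≤ J[S, m] := by
  refine Ideal.span_mono ?_
  rintro _ ⟨β, hS, hn, rfl⟩
  exact ⟨β, hS, h.trans hn, rfl⟩

/-- `J[S, m]` increases in `S`. [folklore] -/
theorem weightedSpan_mono {S T : Set ι} (h : S ⊆ T) (m : ℕ) : J[S, m] ≤ J[T, m] := by
  refine Ideal.span_mono ?_
  rintro _ ⟨β, hS, hm, rfl⟩
  exact ⟨β, hS.trans h, hm, rfl⟩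

/-- `J[S, 0] = A`. [folklore] -/
theorem weightedSpan_zero (S : Set ι) : J[S, 0] = ⊤ := by
  rw [Ideal.eq_top_iff_one]
  exact Ideal.subset_span ⟨0, by simp, by simp, by simp⟩

/-- For `m ≥ 1`, `J[S, m] ⊆ (uᵢ : i ∈ S)`. [folklore] -/
theorem weightedSpan_le_span (S : Set ι) {m : ℕ} (hm : 1 ≤ m) : J[S, m] ≤ Ideal.span (u '' S) := by
  refine Ideal.span_le.mpr ?_
  rintro _ ⟨β, hS, hmβ, rfl⟩
  have hβ : β ≠ 0 := by
    rintro rfl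
    simp at hmβ
    omega
  obtain ⟨i, hi⟩ := Finsupp.ne_iff.mp hβ
  have hi' : i ∈ β.support := Finsupp.mem_support_iff.mpr hi
  rw [SetLike.mem_coe, ← Finsupp.mul_prod_erase β i (fun i e => u i ^ e) hi']
  refine Ideal.mul_mem_right _ _ ?_
  have hpos : 0 < β i := Nat.pos_of_ne_zero hi
  rw [← Nat.sub_add_cancel hpos, pow_succ]
  exact Ideal.mul_mem_left _ _ (Ideal.subset_span ⟨i, hS hi', rfl⟩)

/-- `J[∅, m] = 0` for `m ≥ 1`. [folklore] -/
theorem weightedSpan_empty {m : ℕ} (hm : 1 ≤ m) : J[(∅ : Set ι), m] = ⊥ := by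
  rw [eq_bot_iff]
  refine (weightedSpan_le_span u w ∅ hm).trans ?_
  simp

/-! ## The decomposition `J[S, m] = u_v · J[S, m - w_v] + J[S ∖ {v}, m]` -/

/-- **Splitting off one parameter**: for `v ∈ S`,
`J[S, m] = u_v · J[S, m - w_v] + J[S ∖ {v}, m]` — a monomial either involves `u_v` (and then it is
`u_v` times a monomial of weight `≥ m - w_v`) or is a monomial in the other parameters. (Truncated
subtraction: for `m ≤ w_v` the first summand is the whole principal ideal `(u_v)`.) [folklore] -/
theorem weightedSpan_eq_sup {S : Set ι} {v : ι} (hv : v ∈ S) (m : ℕ) :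
    J[S, m] = Ideal.span {u v} * J[S, m - w v] ⊔ J[S \ {v}, m] := by
  classical
  apply le_antisymm
  · refine Ideal.span_le.mpr ?_
    rintro _ ⟨β, hS, hm, rfl⟩
    by_cases hβv : β v = 0
    · refine Ideal.mem_sup_right (prod_mem_weightedSpan u w ?_ hm)
      intro i hi
      refine ⟨hS hi, ?_⟩
      rintro rfl
      exact (Finsupp.mem_support_iff.mp hi) hβv
    · refine Ideal.mem_sup_left ?_
      have hsplit : β.prod (fun i e => u i ^ e) =
          u v * (β - Finsupp.single v 1).prod (fun i e => u i ^ e) := by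
        conv_lhs => rw [← Finsupp.sub_add_single_one_cancel hβv]
        rw [prod_pow_add, Finsupp.prod_single_index (h := fun i e => u i ^ e) (pow_zero _), pow_one,
          mul_comm]
      rw [hsplit]
      refine Ideal.mul_mem_mul (Ideal.mem_span_singleton_self _) (prod_mem_weightedSpan u w ?_ ?_)
      · exact subset_trans (Finset.coe_subset.mpr Finsupp.support_tsub) hS
      · have h := Finsupp.weight_sub_single_add (w := w) hβv
        omega
  · refine sup_le ?_ (weightedSpan_mono u w Set.sdiff_subset m)
    rw [Ideal.span_mul_span']
    refine Ideal.span_le.mpr ?_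
    rintro _ ⟨a, ha, b, ⟨γ, hS, hm, rfl⟩, rfl⟩
    rw [Set.mem_singleton_iff] at ha
    subst ha
    have hsplit : u v * γ.prod (fun i e => u i ^ e) =
        (γ + Finsupp.single v 1).prod (fun i e => u i ^ e) := by
      rw [prod_pow_add, Finsupp.prod_single_index (h := fun i e => u i ^ e) (pow_zero _), pow_one,
        mul_comm]
    change u v * γ.prod (fun i e => u i ^ e) ∈ J[S, m]
    rw [hsplit]
    refine prod_mem_weightedSpan u w ?_ ?_
    · intro i hi
      have := Finsupp.support_add hi
      rw [Finset.mem_union] at this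
      rcases this with h | h
      · exact hS h
      · rw [Finsupp.support_single _ one_ne_zero, Finset.mem_singleton] at h
        rw [h]; exact hv
    · rw [map_add, Finsupp.weight_single, smul_eq_mul, one_mul]
      omega

/-! ## Colon ideals: `(J[S, m] : x)` and `(J[S, m] : u_v)` for a permutable regular family -/

/-- **Colon lemmas for weighted monomial ideals.** Let `K` be an ideal, `S` a finite set of indices
with positive weights, and suppose the `uᵢ`, `i ∈ S`, form a *permutable regular family modulo
`K`*: each `uᵢ` is a non-zero-divisor modulo `K + (u_t : t ∈ T)` for every `T ⊆ S` not containing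
`i`. Then
(C) any `x` that is a non-zero-divisor modulo every `K + (u_t : t ∈ T)`, `T ⊆ S`, is a
    non-zero-divisor modulo every `K + J[S, m]`;
(D) `(K + J[S, m] : u_v) = K + J[S, m - w_v]` for `v ∈ S`.
Proof by induction on `S` (splitting off `v`) and on `m`. The case of all weights `1` is the
classical `(I^m : u_v) = I^{m-1}` for an ideal `I` generated by a regular sequence
(Matsumura, Thm. 16.2). [folklore] -/
theorem colon_weightedSpan_aux (S : Finset ι) :
    ∀ (K : Ideal A), (∀ i ∈ S, 0 < w i) →
      (∀ i ∈ S, ∀ T : Set ι, T ⊆ ↑S → i ∉ T → ∀ y : A,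
        u i * y ∈ K ⊔ Ideal.span (u '' T) → y ∈ K ⊔ Ideal.span (u '' T)) →
      (∀ (x : A), (∀ T : Set ι, T ⊆ ↑S → ∀ y : A,
          x * y ∈ K ⊔ Ideal.span (u '' T) → y ∈ K ⊔ Ideal.span (u '' T)) →
        ∀ (m : ℕ) (y : A), x * y ∈ K ⊔ J[↑S, m] → y ∈ K ⊔ J[↑S, m]) ∧
      (∀ v ∈ S, ∀ (m : ℕ) (y : A), u v * y ∈ K ⊔ J[↑S, m] → y ∈ K ⊔ J[↑S, m - w v]) := by
  classical
  induction S using Finset.strongInduction with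
  | H S ih =>
    intro K hw hperm
    -- (D) from (C) for `S ∖ {v}` with `x = u_v`
    have hD : ∀ v ∈ S, ∀ (m : ℕ) (y : A), u v * y ∈ K ⊔ J[↑S, m] → y ∈ K ⊔ J[↑S, m - w v] := by
      intro v hv m y hy
      have hsub : S.erase v ⊂ S := Finset.erase_ssubset hv
      have hC' := (ih (S.erase v) hsub K (fun i hi => hw i (Finset.mem_of_mem_erase hi))
        (fun i hi T hT hiT => hperm i (Finset.mem_of_mem_erase hi) T
          (hT.trans (by simp [Finset.coe_erase])) hiT)).1
      rw [weightedSpan_eq_sup u w (Finset.mem_coe.mpr hv), ← sup_assoc] at hy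
      obtain ⟨a, ha, q, hq, haq⟩ := Submodule.mem_sup.mp hy
      obtain ⟨k, hk, b, hb, hkb⟩ := Submodule.mem_sup.mp ha
      obtain ⟨j, hj, rfl⟩ := Ideal.mem_span_singleton_mul.mp hb
      -- `u_v (y - j) = k + q ∈ K + J[S ∖ v, m]`
      have h1 : u v * (y - j) ∈ K ⊔ J[↑(S.erase v), m] := by
        have : u v * (y - j) = k + q := by rw [mul_sub, ← haq, ← hkb]; ring
        rw [this, Finset.coe_erase]
        exact Submodule.add_mem_sup hk hq
      have h2 : y - j ∈ K ⊔ J[↑(S.erase v), m] := by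
        refine hC' (u v) ?_ m (y - j) h1
        intro T hT z hz
        refine hperm v hv T (hT.trans ?_) ?_ z hz
        · rw [Finset.coe_erase]; exact Set.sdiff_subset
        · intro hvT
          have := hT hvT
          rw [Finset.coe_erase] at this
          exact this.2 rfl
      have h3 : K ⊔ J[↑(S.erase v), m] ≤ K ⊔ J[↑S, m - w v] := by
        refine sup_le_sup_left ?_ K
        rw [Finset.coe_erase]
        exact (weightedSpan_mono u w Set.sdiff_subset m).trans (weightedSpan_antitone u w _ (Nat.sub_le m (w v)))
      have h4 : y = (y - j) + j := by ring
      rw [h4]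
      exact Ideal.add_mem _ (h3 h2) (Ideal.mem_sup_right hj)
    refine ⟨?_, hD⟩
    -- (C) by strong induction on `m`
    intro x hx m
    induction m using Nat.strong_induction_on with
    | _ m ihm =>
      intro y hy
      rcases Nat.eq_zero_or_pos m with rfl | hmpos
      · rw [weightedSpan_zero]
        simp
      rcases S.eq_empty_or_nonempty with rfl | ⟨v, hv⟩
      · rw [Finset.coe_empty, weightedSpan_empty u w hmpos, sup_bot_eq] at hy ⊢
        simpa using hx ∅ (Set.empty_subset _) y (by simpa using hy)
      · -- split off `v`
        have hsub : S.erase v ⊂ S := Finset.erase_ssubset hv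
        have hC' := (ih (S.erase v) hsub (K ⊔ Ideal.span {u v})
          (fun i hi => hw i (Finset.mem_of_mem_erase hi)) ?_).1
        · rw [weightedSpan_eq_sup u w (Finset.mem_coe.mpr hv)] at hy
          -- `x y ∈ (K + (u_v)) + J[S ∖ v, m]`
          have hy' : x * y ∈ (K ⊔ Ideal.span {u v}) ⊔ J[↑(S.erase v), m] := by
            rw [Finset.coe_erase]
            refine (show K ⊔ (Ideal.span {u v} * J[↑S, m - w v] ⊔ J[↑S \ {v}, m]) ≤
              (K ⊔ Ideal.span {u v}) ⊔ J[↑S \ {v}, m] from ?_) hy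
            rw [sup_assoc]
            exact sup_le_sup_left (sup_le_sup_right Ideal.mul_le_right _) K
          have hyC : y ∈ (K ⊔ Ideal.span {u v}) ⊔ J[↑(S.erase v), m] := by
            refine hC' x ?_ m y hy'
            intro T hT z hz
            have hT' : insert v T ⊆ ↑S := by
              refine Set.insert_subset (Finset.mem_coe.mpr hv) (hT.trans ?_)
              rw [Finset.coe_erase]; exact Set.sdiff_subset
            have e : K ⊔ Ideal.span {u v} ⊔ Ideal.span (u '' T) = K ⊔ Ideal.span (u '' insert v T) := by
              rw [Set.image_insert_eq, Ideal.span_insert, sup_assoc]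
            rw [e] at hz ⊢
            exact hx (insert v T) hT' z hz
          obtain ⟨a, ha, q, hq, haq⟩ := Submodule.mem_sup.mp hyC
          obtain ⟨k, hk, b, hb, hkb⟩ := Submodule.mem_sup.mp ha
          obtain ⟨y₁, rfl⟩ := Ideal.mem_span_singleton'.mp hb
          -- `u_v (x y₁) = x y - x k - x q ∈ K + J[S, m]`
          have hJsub : J[↑(S.erase v), m] ≤ J[↑S, m] := by
            rw [Finset.coe_erase]; exact weightedSpan_mono u w Set.sdiff_subset m
          have hxy : x * y ∈ K ⊔ J[↑S, m] := by
            rw [weightedSpan_eq_sup u w (Finset.mem_coe.mpr hv)]; exact hy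
          have h1 : u v * (x * y₁) ∈ K ⊔ J[↑S, m] := by
            have : u v * (x * y₁) = x * y - x * k - x * q := by
              rw [← haq, ← hkb]; ring
            rw [this]
            refine Ideal.sub_mem _ (Ideal.sub_mem _ hxy (Ideal.mem_sup_left (Ideal.mul_mem_left _ _ hk)))
              (Ideal.mem_sup_right (Ideal.mul_mem_left _ _ (hJsub hq)))
          have h2 : x * y₁ ∈ K ⊔ J[↑S, m - w v] := hD v hv m _ h1
          have h3 : y₁ ∈ K ⊔ J[↑S, m - w v] :=
            ihm (m - w v) (Nat.sub_lt hmpos (hw v hv)) y₁ h2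
          -- reassemble `y = k + u_v y₁ + q`
          have h4 : y = k + u v * y₁ + q := by rw [← haq, ← hkb]; ring
          rw [h4, weightedSpan_eq_sup u w (Finset.mem_coe.mpr hv), ← sup_assoc]
          refine Ideal.add_mem _ (Ideal.add_mem _ ?_ ?_) ?_
          · exact Ideal.mem_sup_left (Ideal.mem_sup_left hk)
          · obtain ⟨k₁, hk₁, j₁, hj₁, e₁⟩ := Submodule.mem_sup.mp h3
            rw [← e₁, mul_add]
            refine Ideal.add_mem _ (Ideal.mem_sup_left (Ideal.mem_sup_left (Ideal.mul_mem_left _ _ hk₁)))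
              (Ideal.mem_sup_left (Ideal.mem_sup_right ?_))
            exact Ideal.mul_mem_mul (Ideal.mem_span_singleton_self _) hj₁
          · rw [← Finset.coe_erase]
            exact Ideal.mem_sup_right hq
        · -- permutable regularity modulo `K + (u_v)` for the family on `S ∖ v`
          intro i hi T hT hiT z hz
          have hiv : i ≠ v := Finset.ne_of_mem_erase hi
          have hiS : i ∈ S := Finset.mem_of_mem_erase hi
          have hT' : insert v T ⊆ ↑S := by
            refine Set.insert_subset (Finset.mem_coe.mpr hv) (hT.trans ?_)
            rw [Finset.coe_erase]; exact Set.sdiff_subset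
          have e : K ⊔ Ideal.span {u v} ⊔ Ideal.span (u '' T) = K ⊔ Ideal.span (u '' insert v T) := by
            rw [Set.image_insert_eq, Ideal.span_insert, sup_assoc]
          rw [e] at hz ⊢
          refine hperm i hiS (insert v T) hT' ?_ z hz
          rintro (h | h)
          · exact hiv h
          · exact hiT h

end Literature.AlgebraicGeometry.Resolution

end
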